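import Literature.AlgebraicGeometry.Resolution.KnafKuhlmann2009Lemma216
import Literature.AlgebraicGeometry.Resolution.RankOneDensity
import HarnessLib

/-!
# The relative approximation degree of a polynomial (Kuhlmann–Vlahu 2014, §5–8)

Topic: `Literature/AlgebraicGeometry/Resolution` (valued function fields). PROVED beginnings
of the calculus of F.-V. Kuhlmann, I. Vlahu, *The relative approximation degree in valued
function fields*, Math. Z. 276 (2014) 203–235 = arXiv:1304.0200, for TRANSCENDENTAL immediate
approximation types — the tool behind the "pull down principle for henselian rationality
through tame extensions" (op. cit. §14, Thm. 14.5 = Kuhlmann 2019, Thm. 1.3), which is the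
algebraic counterpart of the descent step ([Duc]) in M. Temkin, *Inseparable local
uniformization*, J. Algebra 373 (2013), Thm. 3.2.3, Step 1, on the way to Thm. 3.3.1 = the
named fact `Temkin2013RelativeCurveSmoothFibre`:

> [§7] For the integer `𝐡` that appears in Lemma C4+ … we will write `𝐡_K(x:f)` … We call
> `𝐡(x:f)` the relative approximation degree of `f(x)` in `x` (over `K`) … `1 ≤ 𝐡_K(x:f) ≤ deg f`
> … `v(g(x) − g(c)) = β + k · v(x − c)` for `c ↗ x`. Note that `β` and `k` are uniquely
> determined because as `appr(x,K)` is immediate, there are infinitely many values `v(x − c)`.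
> [Cor. 7.1] The value of `g` is fixed by `A` if and only if `vg(x) = vg(c)` for `c ↗ x`.
> [Lemma 8.2] … for every `b ∈ K` there exists an element `c ∈ K` such that
> `v(f(x) − f(c)) ≥ v(f(x) − b)`.

Setting (the paper's (10.1) minus rank one, in the ambient rendering of
`KnafKuhlmann2009Lemma216.lean` / `ImmediateRationalUniformization.lean`): `K ≤ Ω`, `x ∉ K`
with `(K(x)|K, V)` immediate (`hval`, `hres`) and of transcendental approximation type (`h3`:
every polynomial over `K` has eventually constant value on `K` near `x`; supplied in the tree by
`kaplansky_condition_of_isSepClosed` and `kaplansky_condition_of_split`).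

## Content (everything PROVED; no definitions, no named facts)

* `mul_pow_lt_mul_pow_of_le` — monotone comparison of `αᵢ tⁱ` and `αⱼ tʲ`.
* `exists_approximationDegree` — **the relative approximation degree `𝐡 = 𝐡_K(x:f)` and
  constant `β = β_K(x:f)` of a non-constant polynomial**: eventually `|f_𝐡(c)| = β`, the Taylor
  term of index `𝐡` strictly dominates, and `|f(x) − f(c)| = β |x − c|^𝐡`
  [cite: KuhlmannVlahu2014, Section 7].
* `approximationDegree_unique` — uniqueness of `(β, 𝐡)` [cite: KuhlmannVlahu2014, Section 7].
* `valuation_eval_eq_of_kaplansky` — **Cor. 7.1**: `|g(c)| = |g(x)|` eventually, with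
  `|g(x) − g(c)| < |g(x)|` (or `g(x) = g(c)`) [cite: KuhlmannVlahu2014, Cor. 7.1].
* `exists_valuation_eval_sub_eval_lt` — **Lemma 8.2 (cofinality of `f(K)` around `f(x)`)**
  [cite: KuhlmannVlahu2014, Lemma 8.2].

## Sources

* F.-V. Kuhlmann, I. Vlahu, Math. Z. 276 (2014) 203–235 = arXiv:1304.0200: §5 (Lemma C4+),
  §7 (pp. 15–16), Cor. 7.1, §8 Lemmas 8.1–8.2 (pp. 17–18). [KuhlmannVlahu2014]
* F.-V. Kuhlmann, Israel J. Math. 234 (2019) = arXiv:1701.05508: §4 (approximation type),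
  Thm. 1.3. [Kuhlmann2019]

## Rendering notes

Multiplicative values (`V.valuation`; larger = farther from `0`), so the paper's
"`β + 𝐡 · v(x − c)`" is `β * |x − c|^𝐡` and "`c ↗ x`" is "for all `c ∈ K` with
`|x − c| ≤ |x − a₀|`" for a suitable centre `a₀ ∈ K`; Hasse derivatives `fᵢ = hasseDeriv i f`,
Taylor expansion `taylor`. The relative approximation degree is produced existentially (no
definition): `∃ 𝐡, 1 ≤ 𝐡 ≤ deg f ∧ ∃ β ≠ 0, ∃ a₀ ∈ K, …`, its uniqueness being
`approximationDegree_unique`.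
-/

noncomputable section

open Polynomial Finset

namespace Literature.AlgebraicGeometry.Resolution

universe u

variable {Ω : Type u} [Field Ω] (V : ValuationSubring Ω) (K : Subfield Ω)

/-! ### Monotone comparison of two monomial value functions -/

section Compare

variable {V}

omit K in
/-- If `αᵢ tⁱ > αⱼ tʲ` at `t = t₀` with `i < j`, then the same holds at every `t ≤ t₀`
(`t ≠ 0`). [folklore] -/
theorem mul_pow_lt_mul_pow_of_le {αi αj t t₀ : V.ValueGroup} {i j : ℕ} (hij : i < j)
    (ht : t ≠ 0) (h0 : t ≤ t₀) (h : αj * t₀ ^ j < αi * t₀ ^ i) : αj * t ^ j < αi * t ^ i := by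
  obtain ⟨n, rfl⟩ : ∃ n, j = i + n := ⟨j - i, by omega⟩
  have hn : n ≠ 0 := by omega
  have ht₀ : t₀ ≠ 0 := fun h' => ht (le_antisymm (h' ▸ h0) zero_le)
  -- divide by `t^i`, resp. `t₀^i`
  rw [pow_add, ← mul_assoc] at h ⊢
  have hti : 0 < t₀ ^ i := pow_pos (zero_lt_iff.mpr ht₀) _
  have h1 : αj * t₀ ^ n < αi := by
    have h' : αj * t₀ ^ n * t₀ ^ i < αi * t₀ ^ i := by rw [mul_right_comm]; exact h
    exact lt_of_mul_lt_mul_right h' hti.le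
  have h2 : αj * t ^ n ≤ αj * t₀ ^ n := mul_le_mul' le_rfl (pow_le_pow_left₀ zero_le h0 n)
  calc αj * t ^ i * t ^ n = αj * t ^ n * t ^ i := mul_right_comm _ _ _
    _ < αi * t ^ i := mul_lt_mul_of_pos_right (lt_of_le_of_lt h2 h1) (pow_pos (zero_lt_iff.mpr ht) _)

end Compare

/-! ### The dominant Taylor index -/

section Dominant

/-- **Kuhlmann–Vlahu 2014, Lemma C4+ / §7: the relative approximation degree of a polynomial.**
Let `K ≤ Ω`, `x ∉ K` with `(K(x)|K, V)` immediate (`hval`, `hres`) and of transcendental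
approximation type (`h3`: for every polynomial over `K` the value `|g(a)|` is constant for
`a ∈ K` close to `x`), and let `f` be a non-constant polynomial over `K`. Then there are an index
`𝐡` with `1 ≤ 𝐡 ≤ deg f` — the RELATIVE APPROXIMATION DEGREE `𝐡_K(x:f)` —, a constant `β ≠ 0`
— `|f_𝐡(c)|` for `c` close to `x`, the relative approximation constant — and a centre `a₀ ∈ K`
such that for every `c ∈ K` at least as close to `x` as `a₀`: `|f_𝐡(c)| = β`, the Taylor term
`f_𝐡(c)(x − c)^𝐡` STRICTLY dominates all other Taylor terms `fᵢ(c)(x − c)ⁱ`, `1 ≤ i ≠ 𝐡`, and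
hence `|f(x) − f(c)| = β |x − c|^𝐡` ("`v(f(x) − f(c)) = β_𝐡 + 𝐡 · v(x − c)` for `c ↗ x`").
Here `fᵢ` is the `i`-th Hasse derivative. PROVED: the values `αᵢ = |fᵢ(c)|` are eventually
constant (`h3`); two monomial functions `αᵢ tⁱ`, `αⱼ tʲ` (`i < j`, on the values `t = |x − c|`,
which decrease without minimum as `c ↗ x`) compare eventually strictly and in a fixed direction
(if `αᵢ tⁱ` wins once it wins at all closer `c`; otherwise `αⱼ tʲ` wins strictly everywhere);
the eventual strict linear order on the indices with `αᵢ ≠ 0` has a largest element `𝐡`.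
[cite: KuhlmannVlahu2014, Section 7] -/
theorem exists_approximationDegree {x : Ω} (hxK : x ∉ K)
    (hval : ∀ w ∈ Subfield.closure ((K : Set Ω) ∪ {x}), w ≠ 0 → ∃ b ∈ K,
      V.valuation w = V.valuation b)
    (hres : ∀ w ∈ Subfield.closure ((K : Set Ω) ∪ {x}), w ∈ V → ∃ c ∈ K,
      V.valuation (w - c) < 1)
    (h3 : ∀ g : Polynomial Ω, (∀ k, g.coeff k ∈ K) → ∃ a₀ ∈ K, ∃ α : V.ValueGroup,
      ∀ a ∈ K, V.valuation (x - a) ≤ V.valuation (x - a₀) → V.valuation (g.eval a) = α)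
    {f : Polynomial Ω} (hf : ∀ k, f.coeff k ∈ K) (hdeg : 0 < f.natDegree) :
    ∃ hh : ℕ, 1 ≤ hh ∧ hh ≤ f.natDegree ∧ ∃ β : V.ValueGroup, β ≠ 0 ∧ ∃ a₀ ∈ K,
      ∀ c ∈ K, V.valuation (x - c) ≤ V.valuation (x - a₀) →
        V.valuation ((hasseDeriv hh f).eval c) = β ∧
        (∀ i, 1 ≤ i → i ≠ hh →
          V.valuation ((hasseDeriv i f).eval c * (x - c) ^ i) < β * V.valuation (x - c) ^ hh) ∧
        V.valuation (f.eval x - f.eval c) = β * V.valuation (x - c) ^ hh := by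
  classical
  set n := f.natDegree with hn
  have hxa : ∀ a ∈ K, x - a ≠ 0 := fun a ha h => hxK (by rw [sub_eq_zero.mp h]; exact ha)
  have hvxa : ∀ a ∈ K, V.valuation (x - a) ≠ 0 := fun a ha => (_root_.map_ne_zero _).mpr (hxa a ha)
  ---------------------------------------------------------------- eventual values `α i` of `f_i(c)`
  have h3' : ∀ i : ℕ, ∃ a₀ ∈ K, ∃ α : V.ValueGroup,
      ∀ a ∈ K, V.valuation (x - a) ≤ V.valuation (x - a₀) →
        V.valuation ((hasseDeriv i f).eval a) = α :=
    fun i => h3 _ (coeff_hasseDeriv_mem K hf i)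
  choose ctr hctrK α hα using h3'
  -- a common centre for `i ≤ n`
  obtain ⟨a₁, ha₁K, ha₁⟩ : ∃ a₁ ∈ K, ∀ i ∈ Finset.range (n + 1),
      V.valuation (x - a₁) ≤ V.valuation (x - ctr i) := by
    obtain ⟨i₀, hi₀, hmin⟩ := Finset.exists_min_image (Finset.range (n + 1))
      (fun i => V.valuation (x - ctr i)) ⟨0, Finset.mem_range.mpr (Nat.succ_pos n)⟩
    exact ⟨ctr i₀, hctrK i₀, fun i hi => hmin i hi⟩
  have hαc : ∀ i ∈ Finset.range (n + 1), ∀ c ∈ K, V.valuation (x - c) ≤ V.valuation (x - a₁) →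
      V.valuation ((hasseDeriv i f).eval c) = α i :=
    fun i hi c hc hle => hα i c hc (hle.trans (ha₁ i hi))
  -- the top index has `α n ≠ 0`: `f_n = lc(f)` is a non-zero constant
  have hαn : α n ≠ 0 := by
    have hc : (hasseDeriv n f).eval a₁ = f.leadingCoeff := by
      have h1 : hasseDeriv n f = C (f.coeff n) := by
        ext k
        rw [hasseDeriv_coeff, coeff_C]
        rcases Nat.eq_zero_or_pos k with rfl | hk
        · simp
        · rw [if_neg hk.ne', coeff_eq_zero_of_natDegree_lt (by omega), mul_zero]
      rw [h1, eval_C]; rfl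
    rw [← hαc n (Finset.self_mem_range_succ n) a₁ ha₁K le_rfl, hc]
    exact (_root_.map_ne_zero _).mpr (leadingCoeff_ne_zero.mpr (ne_zero_of_natDegree_gt hdeg))
  ---------------------------------------------------------------- the terms and their comparison
  -- `term i c = α i * |x - c|^i`
  have hterm : ∀ i ∈ Finset.range (n + 1), ∀ c ∈ K, V.valuation (x - c) ≤ V.valuation (x - a₁) →
      V.valuation ((hasseDeriv i f).eval c * (x - c) ^ i) = α i * V.valuation (x - c) ^ i := by
    intro i hi c hc hle
    rw [map_mul, map_pow, hαc i hi c hc hle]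
  -- pairwise eventual strict comparison in a fixed direction, for `i < j` with `α i, α j ≠ 0`
  have hpair : ∀ i j : ℕ, i < j → α i ≠ 0 → α j ≠ 0 →
      ∃ a ∈ K, V.valuation (x - a) ≤ V.valuation (x - a₁) ∧
        ((∀ c ∈ K, V.valuation (x - c) ≤ V.valuation (x - a) →
            α j * V.valuation (x - c) ^ j < α i * V.valuation (x - c) ^ i) ∨
         (∀ c ∈ K, V.valuation (x - c) ≤ V.valuation (x - a) →
            α i * V.valuation (x - c) ^ i < α j * V.valuation (x - c) ^ j)) := by
    intro i j hij hαi hαj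
    by_cases hP : ∃ c₀ ∈ K, V.valuation (x - c₀) ≤ V.valuation (x - a₁) ∧
        α j * V.valuation (x - c₀) ^ j < α i * V.valuation (x - c₀) ^ i
    · obtain ⟨c₀, hc₀K, hc₀le, hc₀⟩ := hP
      refine ⟨c₀, hc₀K, hc₀le, Or.inl fun c hc hle => ?_⟩
      exact mul_pow_lt_mul_pow_of_le hij (hvxa c hc) hle hc₀
    · push Not at hP
      refine ⟨a₁, ha₁K, le_rfl, Or.inr fun c hc hle => ?_⟩
      refine lt_of_le_of_ne (hP c hc hle) fun heq => ?_
      -- equality at `c` would make `i` win at any closer `c'`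
      obtain ⟨c', hc'K, hlt⟩ := exists_valuation_sub_lt V K hxK hval hres hc
      have hwin : α j * V.valuation (x - c') ^ j < α i * V.valuation (x - c') ^ i := by
        obtain ⟨m, hm'⟩ : ∃ m, j = i + m := ⟨j - i, by omega⟩
        have hm : m ≠ 0 := by omega
        have ht : V.valuation (x - c) ≠ 0 := hvxa c hc
        have ht' : V.valuation (x - c') ≠ 0 := hvxa c' hc'K
        have hpj : ∀ t : V.ValueGroup, t ^ j = t ^ m * t ^ i := fun t => by
          rw [hm', pow_add, mul_comm]
        -- from `αi t^i = αj t^m t^i`: `αi = αj t^m`, and `t'^m < t^m`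
        have h1 : α i = α j * V.valuation (x - c) ^ m := by
          rw [hpj, ← mul_assoc] at heq
          exact mul_right_cancel₀ (pow_ne_zero _ ht) heq
        have h2 : α j * V.valuation (x - c') ^ m < α j * V.valuation (x - c) ^ m :=
          mul_lt_mul_of_pos_left (pow_lt_pow_left₀ hlt zero_le hm) (zero_lt_iff.mpr hαj)
        rw [hpj, ← mul_assoc, h1]
        exact mul_lt_mul_of_pos_right h2 (pow_pos (zero_lt_iff.mpr ht') _)
      exact absurd hwin (not_lt.mpr (hP c' hc'K (hlt.le.trans hle)))
  choose! pc hpcK hpcle hpc using hpair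
  ---------------------------------------------------------------- the final centre `a₀`
  -- the relevant index set and pairs
  set S : Finset ℕ := (Finset.range (n + 1)).filter fun i => 1 ≤ i ∧ α i ≠ 0 with hS
  have hnS : n ∈ S := Finset.mem_filter.mpr ⟨Finset.self_mem_range_succ n, hdeg, hαn⟩
  have hSne : S.Nonempty := ⟨n, hnS⟩
  set P : Finset (ℕ × ℕ) := (S ×ˢ S).filter fun q => q.1 < q.2 with hP
  -- `a₀`: as close as `a₁` and all the `pc i j`
  obtain ⟨a₀, ha₀K, ha₀a₁, ha₀P⟩ : ∃ a₀ ∈ K, V.valuation (x - a₀) ≤ V.valuation (x - a₁) ∧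
      ∀ q ∈ P, V.valuation (x - a₀) ≤ V.valuation (x - pc q.1 q.2) := by
    by_cases hPne : P.Nonempty
    · obtain ⟨q₀, hq₀, hmin⟩ :=
        Finset.exists_min_image P (fun q => V.valuation (x - pc q.1 q.2)) hPne
      have hq₀' := Finset.mem_filter.mp hq₀
      obtain ⟨hq₀S, hlt₀⟩ := hq₀'
      obtain ⟨h1S, h2S⟩ := Finset.mem_product.mp hq₀S
      have hα1 := (Finset.mem_filter.mp h1S).2.2
      have hα2 := (Finset.mem_filter.mp h2S).2.2
      exact ⟨pc q₀.1 q₀.2, hpcK _ _ hlt₀ hα1 hα2, hpcle _ _ hlt₀ hα1 hα2, fun q hq => hmin q hq⟩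
    · exact ⟨a₁, ha₁K, le_rfl, fun q hq => (hPne ⟨q, hq⟩).elim⟩
  -- for `c` closer than `a₀`, the strict comparison of any two indices of `S` is FIXED
  have hfixed : ∀ i ∈ S, ∀ j ∈ S, i < j →
      (∀ c ∈ K, V.valuation (x - c) ≤ V.valuation (x - a₀) →
          α j * V.valuation (x - c) ^ j < α i * V.valuation (x - c) ^ i) ∨
        (∀ c ∈ K, V.valuation (x - c) ≤ V.valuation (x - a₀) →
          α i * V.valuation (x - c) ^ i < α j * V.valuation (x - c) ^ j) := by
    intro i hi j hj hij
    have hαi := (Finset.mem_filter.mp hi).2.2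
    have hαj := (Finset.mem_filter.mp hj).2.2
    have hq : (i, j) ∈ P := Finset.mem_filter.mpr ⟨Finset.mem_product.mpr ⟨hi, hj⟩, hij⟩
    have hle : ∀ c ∈ K, V.valuation (x - c) ≤ V.valuation (x - a₀) →
        V.valuation (x - c) ≤ V.valuation (x - pc i j) := fun c _ h => h.trans (ha₀P _ hq)
    rcases hpc i j hij hαi hαj with h | h
    · exact Or.inl fun c hc hcle => h c hc (hle c hc hcle)
    · exact Or.inr fun c hc hcle => h c hc (hle c hc hcle)
  ---------------------------------------------------------------- the dominant index at `a₀`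
  set τ : ℕ → V.ValueGroup := fun i => α i * V.valuation (x - a₀) ^ i with hτ
  obtain ⟨hh, hhhS, hmax⟩ := Finset.exists_max_image S τ hSne
  obtain ⟨hhhrg, hhh1, hαhh⟩ := Finset.mem_filter.mp hhhS
  have hhhn : hh ≤ n := Nat.lt_succ_iff.mp (Finset.mem_range.mp hhhrg)
  -- `hh` strictly dominates every other index of `S` at every `c` closer than `a₀`
  have hdom : ∀ i ∈ S, i ≠ hh → ∀ c ∈ K, V.valuation (x - c) ≤ V.valuation (x - a₀) →
      α i * V.valuation (x - c) ^ i < α hh * V.valuation (x - c) ^ hh := by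
    intro i hi hne c hc hle
    rcases Nat.lt_or_gt_of_ne hne with hlt | hgt
    · rcases hfixed i hi hh hhhS hlt with h | h
      · exact absurd (hmax i hi) (not_le.mpr (h a₀ ha₀K le_rfl))
      · exact h c hc hle
    · rcases hfixed hh hhhS i hi hgt with h | h
      · exact h c hc hle
      · exact absurd (hmax i hi) (not_le.mpr (h a₀ ha₀K le_rfl))
  ---------------------------------------------------------------- conclusion
  refine ⟨hh, hhh1, hhhn, α hh, hαhh, a₀, ha₀K, fun c hc hle => ?_⟩
  have hlea₁ : V.valuation (x - c) ≤ V.valuation (x - a₁) := hle.trans ha₀a₁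
  have hrg : ∀ i, 1 ≤ i → i ≤ n → i ∈ Finset.range (n + 1) := fun i _ hi =>
    Finset.mem_range.mpr (Nat.lt_succ_of_le hi)
  -- every other term of positive index is strictly smaller
  have hlt : ∀ i, 1 ≤ i → i ≠ hh →
      V.valuation ((hasseDeriv i f).eval c * (x - c) ^ i) < α hh * V.valuation (x - c) ^ hh := by
    intro i hi1 hne
    have hpos : 0 < α hh * V.valuation (x - c) ^ hh :=
      mul_pos (zero_lt_iff.mpr hαhh) (pow_pos (zero_lt_iff.mpr (hvxa c hc)) _)
    by_cases hin : i ≤ n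
    · rw [hterm i (hrg i hi1 hin) c hc hlea₁]
      by_cases hαi : α i = 0
      · rw [hαi, zero_mul]; exact hpos
      · exact hdom i (Finset.mem_filter.mpr ⟨hrg i hi1 hin, hi1, hαi⟩) hne c hc hle
    · -- `i > n`: the Hasse derivative vanishes
      have h0 : hasseDeriv i f = 0 := by
        apply hasseDeriv_eq_zero_of_lt_natDegree
        omega
      rw [h0, eval_zero, zero_mul, map_zero]
      exact hpos
  refine ⟨hαc hh hhhrg c hc hlea₁, hlt, ?_⟩
  -- Taylor expansion at `c`: `f(x) - f(c) = Σ_{1 ≤ i ≤ n} f_i(c) (x - c)^i`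
  have htaylor : f.eval x - f.eval c =
      ∑ i ∈ Finset.Icc 1 n, (hasseDeriv i f).eval c * (x - c) ^ i := by
    have h1 : f.eval x = (taylor c f).eval (x - c) := by rw [taylor_eval, sub_add_cancel]
    have hdegT : (taylor c f).natDegree < n + 1 := by rw [natDegree_taylor]; omega
    rw [h1, eval_eq_sum_range' hdegT, Finset.range_eq_Ico, Finset.sum_eq_sum_Ico_succ_bot
      (Nat.succ_pos n)]
    simp only [taylor_coeff, hasseDeriv_zero, LinearMap.id_apply, pow_zero, mul_one]
    have hIco : Finset.Ico 1 (n + 1) = Finset.Icc 1 n := by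
      ext i; simp
    rw [hIco]
    ring
  rw [htaylor]
  have hhhmem : hh ∈ Finset.Icc 1 n := Finset.mem_Icc.mpr ⟨hhh1, hhhn⟩
  rw [Valuation.map_sum_eq_of_lt (j := hh) _ hhhmem]
  · exact hterm hh hhhrg c hc hlea₁
  · intro i hi
    rw [Finset.mem_sdiff, Finset.mem_singleton, Finset.mem_Icc] at hi
    rw [hterm hh hhhrg c hc hlea₁]
    exact hlt i hi.1.1 hi.2

end Dominant

/-! ### Uniqueness of the representation `β · |x − c|^𝐡` -/

section Unique

/-- **The pair `(β, 𝐡)` is unique**: if `β t^k = β' t^{k'}` for the values `t = |x − c|` of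
all `c ∈ K` at least as close to `x` as some `a ∈ K` (there are at least two such values:
`K(x)|K` immediate with `x ∉ K`), then `k = k'` and `β = β'` (`β, β' ≠ 0`).
[cite: KuhlmannVlahu2014, Section 7] -/
theorem approximationDegree_unique {x : Ω} (hxK : x ∉ K)
    (hval : ∀ w ∈ Subfield.closure ((K : Set Ω) ∪ {x}), w ≠ 0 → ∃ b ∈ K,
      V.valuation w = V.valuation b)
    (hres : ∀ w ∈ Subfield.closure ((K : Set Ω) ∪ {x}), w ∈ V → ∃ c ∈ K,
      V.valuation (w - c) < 1)
    {a : Ω} (haK : a ∈ K) {β β' : V.ValueGroup} (hβ : β ≠ 0) (hβ' : β' ≠ 0) {k k' : ℕ}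
    (h : ∀ c ∈ K, V.valuation (x - c) ≤ V.valuation (x - a) →
      β * V.valuation (x - c) ^ k = β' * V.valuation (x - c) ^ k') :
    k = k' ∧ β = β' := by
  have hxa : ∀ c ∈ K, V.valuation (x - c) ≠ 0 := fun c hc =>
    (_root_.map_ne_zero _).mpr fun h0 => hxK (by rw [sub_eq_zero.mp h0]; exact hc)
  obtain ⟨c, hcK, hlt⟩ := exists_valuation_sub_lt V K hxK hval hres haK
  have h1 := h a haK le_rfl
  have h2 := h c hcK hlt.le
  have ht0 : V.valuation (x - a) ≠ 0 := hxa a haK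
  have ht'0 : V.valuation (x - c) ≠ 0 := hxa c hcK
  have hkk' : k = k' := by
    by_contra hne
    have key : ∀ {m m' : ℕ} {γ γ' : V.ValueGroup}, γ' ≠ 0 → m < m' →
        γ * V.valuation (x - a) ^ m = γ' * V.valuation (x - a) ^ m' →
        γ * V.valuation (x - c) ^ m = γ' * V.valuation (x - c) ^ m' → False := by
      intro m m' γ γ' hγ' hmm' e1 e2
      obtain ⟨d, rfl⟩ : ∃ d, m' = m + d := ⟨m' - m, by omega⟩
      have hd : d ≠ 0 := by omega
      rw [pow_add, ← mul_assoc] at e1 e2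
      have e1' : γ = γ' * V.valuation (x - a) ^ d := by
        rw [mul_right_comm] at e1; exact mul_right_cancel₀ (pow_ne_zero _ ht0) e1
      have e2' : γ = γ' * V.valuation (x - c) ^ d := by
        rw [mul_right_comm] at e2; exact mul_right_cancel₀ (pow_ne_zero _ ht'0) e2
      have hpow : V.valuation (x - a) ^ d = V.valuation (x - c) ^ d :=
        mul_left_cancel₀ hγ' (e1'.symm.trans e2')
      have htt' : V.valuation (x - a) = V.valuation (x - c) :=
        (pow_left_strictMonoOn₀ hd).injOn zero_le zero_le hpow
      rw [htt'] at hlt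
      exact lt_irrefl _ hlt
    rcases Nat.lt_or_gt_of_ne hne with hlt' | hgt
    · exact key hβ' hlt' h1 h2
    · exact key hβ hgt h1.symm h2.symm
  refine ⟨hkk', ?_⟩
  rw [hkk'] at h1
  exact mul_right_cancel₀ (pow_ne_zero _ ht0) h1

end Unique

/-! ### The value of a polynomial at `x` is its eventual value (Kuhlmann–Vlahu 2014, Cor. 7.1) -/

section Value

/-- **The approximation type fixes the value of every polynomial, and the fixed value is the
value at `x`** (Kuhlmann–Vlahu 2014, Cor. 7.1, for transcendental approximation types: "The
value of `g` is fixed by `A` if and only if `vg(x) = vg(c)` for `c ↗ x`"): for `g` over `K`,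
`|g(c)| = |g(x)|` for all `c ∈ K` close enough to `x`, and moreover `|g(x) − g(c)| < |g(x)|`
unless `g(x) = g(c)`. PROVED: if `g` is constant this is trivial; otherwise
`|g(x) − g(c)| = β |x − c|^𝐡` decreases strictly without end as `c ↗ x` while `|g(c)| = α` is
constant, so eventually `|g(x) − g(c)| < |g(c)|`. [cite: KuhlmannVlahu2014, Cor. 7.1] -/
theorem valuation_eval_eq_of_kaplansky {x : Ω} (hxK : x ∉ K)
    (hval : ∀ w ∈ Subfield.closure ((K : Set Ω) ∪ {x}), w ≠ 0 → ∃ b ∈ K,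
      V.valuation w = V.valuation b)
    (hres : ∀ w ∈ Subfield.closure ((K : Set Ω) ∪ {x}), w ∈ V → ∃ c ∈ K,
      V.valuation (w - c) < 1)
    (h3 : ∀ g : Polynomial Ω, (∀ k, g.coeff k ∈ K) → ∃ a₀ ∈ K, ∃ α : V.ValueGroup,
      ∀ a ∈ K, V.valuation (x - a) ≤ V.valuation (x - a₀) → V.valuation (g.eval a) = α)
    {g : Polynomial Ω} (hg : ∀ k, g.coeff k ∈ K) :
    ∃ a₀ ∈ K, ∀ c ∈ K, V.valuation (x - c) ≤ V.valuation (x - a₀) →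
      V.valuation (g.eval c) = V.valuation (g.eval x) ∧
      (V.valuation (g.eval x - g.eval c) < V.valuation (g.eval x) ∨ g.eval x = g.eval c) := by
  classical
  by_cases hdeg : g.natDegree = 0
  · -- constant polynomial
    obtain ⟨c₀, hc₀⟩ := natDegree_eq_zero.mp hdeg
    refine ⟨0, K.zero_mem, fun c _ _ => ?_⟩
    rw [← hc₀, eval_C, eval_C]
    exact ⟨rfl, Or.inr rfl⟩
  obtain ⟨k, hk1, -, β, hβ, a₀, ha₀K, hk⟩ :=
    exists_approximationDegree V K hxK hval hres h3 hg (Nat.pos_of_ne_zero hdeg)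
  have hk0 : k ≠ 0 := by omega
  obtain ⟨a₁, ha₁K, α, hα⟩ := h3 g hg
  -- a common centre `a₂`, then two steps closer: `a₃`, `a₄`
  obtain ⟨a₂, ha₂K, ha₂⟩ : ∃ a₂ ∈ K, V.valuation (x - a₂) ≤ V.valuation (x - a₀) ∧
      V.valuation (x - a₂) ≤ V.valuation (x - a₁) := by
    rcases le_total (V.valuation (x - a₀)) (V.valuation (x - a₁)) with h | h
    · exact ⟨a₀, ha₀K, le_rfl, h⟩
    · exact ⟨a₁, ha₁K, h, le_rfl⟩
  obtain ⟨a₃, ha₃K, h₃⟩ := exists_valuation_sub_lt V K hxK hval hres ha₂K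
  obtain ⟨a₄, ha₄K, h₄⟩ := exists_valuation_sub_lt V K hxK hval hres ha₃K
  -- the difference `|g(x) - g(c)| = β t^k` and the value `|g(c)| = α` near `x`
  have hdiff : ∀ c ∈ K, V.valuation (x - c) ≤ V.valuation (x - a₂) →
      V.valuation (g.eval x - g.eval c) = β * V.valuation (x - c) ^ k :=
    fun c hc hle => (hk c hc (hle.trans ha₂.1)).2.2
  have hvalc : ∀ c ∈ K, V.valuation (x - c) ≤ V.valuation (x - a₂) →
      V.valuation (g.eval c) = α := fun c hc hle => hα c hc (hle.trans ha₂.2)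
  -- Step 1: `β t₃^k ≤ α` (else two different values for `|g(x)|`)
  have hstep1 : β * V.valuation (x - a₃) ^ k ≤ α := by
    by_contra hlt
    push Not at hlt
    have hmono : β * V.valuation (x - a₃) ^ k < β * V.valuation (x - a₂) ^ k :=
      mul_lt_mul_of_pos_left (pow_lt_pow_left₀ h₃ zero_le hk0) (zero_lt_iff.mpr hβ)
    have hv3 : V.valuation (g.eval x) = β * V.valuation (x - a₃) ^ k := by
      have hid : g.eval x = g.eval a₃ + (g.eval x - g.eval a₃) := by ring
      rw [hid, Valuation.map_add_eq_of_lt_right]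
      · exact hdiff a₃ ha₃K h₃.le
      · rw [hvalc a₃ ha₃K h₃.le, hdiff a₃ ha₃K h₃.le]; exact hlt
    have hv2 : V.valuation (g.eval x) = β * V.valuation (x - a₂) ^ k := by
      have hid : g.eval x = g.eval a₂ + (g.eval x - g.eval a₂) := by ring
      rw [hid, Valuation.map_add_eq_of_lt_right]
      · exact hdiff a₂ ha₂K le_rfl
      · rw [hvalc a₂ ha₂K le_rfl, hdiff a₂ ha₂K le_rfl]; exact hlt.trans hmono
    exact absurd (hv3.symm.trans hv2) (ne_of_lt hmono)
  -- Step 2: for `c` at least as close as `a₄`: `β t^k < α`, hence the claims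
  refine ⟨a₄, ha₄K, fun c hc hle => ?_⟩
  have hc₂ : V.valuation (x - c) ≤ V.valuation (x - a₂) := hle.trans (h₄.le.trans h₃.le)
  have hlt : β * V.valuation (x - c) ^ k < α :=
    calc β * V.valuation (x - c) ^ k ≤ β * V.valuation (x - a₄) ^ k :=
          mul_le_mul' le_rfl (pow_le_pow_left₀ zero_le hle k)
      _ < β * V.valuation (x - a₃) ^ k :=
          mul_lt_mul_of_pos_left (pow_lt_pow_left₀ h₄ zero_le hk0) (zero_lt_iff.mpr hβ)
      _ ≤ α := hstep1
  have hvx : V.valuation (g.eval x) = α := by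
    have hid : g.eval x = g.eval c + (g.eval x - g.eval c) := by ring
    rw [hid, Valuation.map_add_eq_of_lt_left, hvalc c hc hc₂]
    rw [hvalc c hc hc₂, hdiff c hc hc₂]; exact hlt
  refine ⟨by rw [hvalc c hc hc₂, hvx], Or.inl ?_⟩
  rw [hdiff c hc hc₂, hvx]; exact hlt

/-- **`f(K)` is cofinal around `f(x)`** (Kuhlmann–Vlahu 2014, Lemma 8.2: "for every `b ∈ K`
there exists `c ∈ K` such that `v(f(x) − f(c)) ≥ v(f(x) − b)`" — here strictly, `f`
non-constant and `x` transcendental): for `b ∈ K` and any `a ∈ K` there is `c ∈ K` at least as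
close to `x` as `a` with `|f(x) − f(c)| < |f(x) − b|`. [cite: KuhlmannVlahu2014, Lemma 8.2] -/
theorem exists_valuation_eval_sub_eval_lt {x : Ω}
    (htrans : ∀ P : Polynomial Ω, (∀ k, P.coeff k ∈ K) → P.eval x = 0 → P = 0)
    (hval : ∀ w ∈ Subfield.closure ((K : Set Ω) ∪ {x}), w ≠ 0 → ∃ b ∈ K,
      V.valuation w = V.valuation b)
    (hres : ∀ w ∈ Subfield.closure ((K : Set Ω) ∪ {x}), w ∈ V → ∃ c ∈ K,
      V.valuation (w - c) < 1)
    (h3 : ∀ g : Polynomial Ω, (∀ k, g.coeff k ∈ K) → ∃ a₀ ∈ K, ∃ α : V.ValueGroup,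
      ∀ a ∈ K, V.valuation (x - a) ≤ V.valuation (x - a₀) → V.valuation (g.eval a) = α)
    {f : Polynomial Ω} (hf : ∀ k, f.coeff k ∈ K) (hdeg : 0 < f.natDegree)
    {b : Ω} (hbK : b ∈ K) {a : Ω} (haK : a ∈ K) :
    ∃ c ∈ K, V.valuation (x - c) ≤ V.valuation (x - a) ∧
      V.valuation (f.eval x - f.eval c) < V.valuation (f.eval x - b) := by
  classical
  have hxK : x ∉ K := not_mem_of_forall_eval_eq_zero K htrans
  -- `g = f - b`
  set g : Polynomial Ω := f - C b with hgdef
  have hg : ∀ k, g.coeff k ∈ K := fun k => by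
    rw [hgdef, coeff_sub, coeff_C]
    split_ifs
    · exact sub_mem (hf k) hbK
    · rw [sub_zero]; exact hf k
  have hgeval : ∀ y, g.eval y = f.eval y - b := fun y => by rw [hgdef, eval_sub, eval_C]
  obtain ⟨a₀, ha₀K, h0⟩ := valuation_eval_eq_of_kaplansky V K hxK hval hres h3 hg
  -- a common centre
  obtain ⟨a₁, ha₁K, ha₁⟩ : ∃ a₁ ∈ K, V.valuation (x - a₁) ≤ V.valuation (x - a₀) ∧
      V.valuation (x - a₁) ≤ V.valuation (x - a) := by
    rcases le_total (V.valuation (x - a₀)) (V.valuation (x - a)) with h | h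
    · exact ⟨a₀, ha₀K, le_rfl, h⟩
    · exact ⟨a, haK, h, le_rfl⟩
  refine ⟨a₁, ha₁K, ha₁.2, ?_⟩
  have h1 : g.eval x - g.eval a₁ = f.eval x - f.eval a₁ := by rw [hgeval, hgeval]; ring
  rcases (h0 a₁ ha₁K ha₁.1).2 with hlt | heq
  · rwa [h1, hgeval] at hlt
  · -- `g(x) = g(a₁)` would make `x` a root of the non-zero `f - f(a₁)` over `K`
    exfalso
    have hfa₁K : f.eval a₁ ∈ K := eval_mem_subfield_of_coeff_mem hf ha₁K
    have hcoef : ∀ k, (f - C (f.eval a₁)).coeff k ∈ K := fun k => by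
      rw [coeff_sub, coeff_C]
      split_ifs
      · exact sub_mem (hf k) hfa₁K
      · rw [sub_zero]; exact hf k
    have hroot : (f - C (f.eval a₁)).eval x = 0 := by
      rw [eval_sub, eval_C, ← h1, heq, sub_self]
    have h := htrans _ hcoef hroot
    have : (f - C (f.eval a₁)).natDegree = f.natDegree := natDegree_sub_C
    rw [h, natDegree_zero] at this
    omega

end Value

end Literature.AlgebraicGeometry.Resolution
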